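import Literature.Topology.RestrictedProductQuotient
import Literature.MeasureTheory.RestrictedProduct.ActionInvariant
import Literature.MeasureTheory.RestrictedProduct.ProductIntegralMonotone
import HarnessLib

/-!
# Restricted product measures, XI: the product of local invariant measures on the adelic coset space
# `(Πʳ_i G_i) ⧸ M ≃ₜ Πʳ_i (G_i ⧸ H_i)` and the Euler product of factorizable integrands

Topic `MeasureTheory/RestrictedProduct`; continues `ActionInvariant` (restricted product of invariant measures on
homogeneous data) along the homeomorphism `quotientHomeomorph` of `Literature/Topology/RestrictedProductQuotient`.
THEOREMS ONLY (no definition, no instance): the measure on the coset space is the EXPRESSION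
`(rpMeasure (quotBase K H) m S₀).map (quotientHomeomorph K H M hM hK).symm`.

Setting: countably many topological groups `G i`, OPEN subgroups `K i` (`Fact (∀ i, IsOpen K_i)`, so that
`Πʳ i, [G i, K i]` is a topological group), subgroups `H i` with second-countable coset spaces `G i ⧸ H i`
carrying Borel σ-algebras and σ-finite local measures `m i`, normalised by `m i (π_i K_i) = 1` off a finite `S₀`
(a PARAMETER, F0P3a-ref1 req. (3)); `M ≤ Πʳ i, [G i, K i]` any subgroup with `x ∈ M ↔ ∀ i, x_i ∈ H_i` (e.g. the
centraliser of an adelic `γ`, `H_i = C(γ_i)`), the coset space `(Πʳ G_i) ⧸ M` with a Borel σ-algebra.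

* `borelSpace_quot`, `measurable_quotientHomeomorph[_symm]` — Borel book-keeping (`RestrictedProduct/Borel`);
* `map_quotientHomeomorph_symm_apply` — `μ_Q(A) = μ(e '' A)`; `lintegral_/integral_map_quotientHomeomorph_symm`;
* **`smulInvariantMeasure_map_quotientHomeomorph_symm`** — `μ_Q` is INVARIANT under the left action of
  `Πʳ G_i` on `(Πʳ G_i) ⧸ M` when the `m i` are `G i`-invariant (`ActionInvariant` + the equivariance
  `quotientHomeomorph_smul_apply`);
* **`isFiniteMeasureOnCompacts_map_quotientHomeomorph_symm`**, **`map_quotientHomeomorph_symm_ne_zero`** —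
  finite on compacta, non-zero: the three fields the tree's orbital-term pins (`UnitaryGroup.IsOrbitalTerms`,
  `OrbitalMeasureFamily.IsAdmissible`) ask of an orbital measure;
* **`lintegral_map_quotientHomeomorph_symm_eq_iSup_prod`** / `…_eq_prod` / `integral_…_eq_prod` /
  `tendsto_prod_integral_…` — the EULER PRODUCT on the coset space: for `F : (Πʳ G_i) ⧸ M → ℝ≥0∞` (or `𝕜`) with
  `F(x M) = ∏_{i∈S} φ_i(x_i H_i)` whenever `x_i ∈ K_i` off `S` (`S ⊇ S₀`) — the shape of the orbital integrand of
  a pure tensor `⊗ f_v` unramified off `S₀`, `φ_v(y) = f_v(y γ_v y⁻¹)` — one has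
  `∫ F dμ_Q = ⨆_{S ⊇ S₀} ∏_{i∈S} ∫ φ_i dm_i`, resp. `= ∏_{i∈S₁} ∫ φ_i dm_i` once the local integrals are `1` off
  `S₁` (Tate's Thm 3.3.1 via `ProductIntegralMonotone`, transported).

References: Cassels–Fröhlich (1967) Ch. XV (Tate) §3.3 [CasselsFrohlichANT1967]; Borel–Jacquet (1979) §4.1
[BorelJacquet1979]; Gelbart (1975) (9.13)–(9.14) (Euler product of orbital integrals) [Gelbart1975]. Written for
the cell `pub/hodgecm-mathlib`, ENGINE T1, plan O13c (file Q1c-B).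
-/

noncomputable section

open _root_.MeasureTheory Set Filter Function
open _root_.Topology
open Literature.Topology.RestrictedProduct

open scoped RestrictedProduct ENNReal Pointwise

namespace Literature.MeasureTheory.RestrictedProduct

universe u v

variable {ι : Type u} {G : ι → Type v} [∀ i, Group (G i)] [∀ i, TopologicalSpace (G i)]
  [∀ i, IsTopologicalGroup (G i)] (K : ∀ i, Subgroup (G i)) (H : ∀ i, Subgroup (G i))
  [hKo : Fact (∀ i, IsOpen (K i : Set (G i)))]
  [∀ i, MeasurableSpace (G i ⧸ H i)] [∀ i, BorelSpace (G i ⧸ H i)]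

/-! ## The local base sets as measurable data -/

omit [∀ i, TopologicalSpace (G i)] [∀ i, IsTopologicalGroup (G i)] hKo [∀ i, MeasurableSpace (G i ⧸ H i)]
  [∀ i, BorelSpace (G i ⧸ H i)] in
/-- The base sets `π_i(K_i)` are non-empty. [cite: BorelJacquet1979, §4.1] -/
theorem quotBase_nonempty (i : ι) : (quotBase K H i).Nonempty := ⟨_, one_mem_quotBase K H i⟩

/-- The base sets `π_i(K_i)` are measurable (open, Borel σ-algebra). [cite: BorelJacquet1979, §4.1] -/
theorem measurableSet_quotBase (i : ι) : MeasurableSet (quotBase K H i) :=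
  (isOpen_quotBase K H (hKo.out i)).measurableSet

omit [∀ i, TopologicalSpace (G i)] [∀ i, IsTopologicalGroup (G i)] hKo [∀ i, MeasurableSpace (G i ⧸ H i)]
  [∀ i, BorelSpace (G i ⧸ H i)] in
/-- The base sets are `K_i`-stable: `k • π_i(K_i) = π_i(K_i)`. [cite: BorelJacquet1979, §4.1] -/
theorem forall_smul_quotBase_eq : ∀ i, ∀ k ∈ K i, k • quotBase K H i = quotBase K H i :=
  fun _ _ hk => smul_quotBase_eq K H hk

variable [Countable ι] [∀ i, SecondCountableTopology (G i ⧸ H i)]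
  (M : Subgroup (Πʳ i, [G i, K i])) (hM : ∀ x : Πʳ i, [G i, K i], x ∈ M ↔ ∀ i, x i ∈ H i)
  [MeasurableSpace ((Πʳ i, [G i, K i]) ⧸ M)] [BorelSpace ((Πʳ i, [G i, K i]) ⧸ M)]

/-! ## Borel book-keeping for the homeomorphism -/

/-- The trace σ-algebra of `Πʳ i, [G i ⧸ H i, π_i(K_i)]` is its Borel σ-algebra. [cite: CasselsFrohlichANT1967, Ch. XV (Tate) §3.3] -/
theorem borelSpace_quot : BorelSpace (Πʳ i, [G i ⧸ H i, quotBase K H i]) :=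
  borelSpace (fun i => quotBase K H i) (measurableSet_quotBase K H)

/-- The homeomorphism `(Πʳ G_i) ⧸ M ≃ₜ Πʳ (G_i ⧸ H_i)` is measurable. [cite: BorelJacquet1979, §4.1] -/
theorem measurable_quotientHomeomorph : Measurable (quotientHomeomorph K H M hM hKo.out) := by
  haveI := borelSpace_quot K H
  exact (quotientHomeomorph K H M hM hKo.out).continuous.measurable

/-- Its inverse is measurable. [cite: BorelJacquet1979, §4.1] -/
theorem measurable_quotientHomeomorph_symm : Measurable (quotientHomeomorph K H M hM hKo.out).symm := by
  haveI := borelSpace_quot K H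
  exact (quotientHomeomorph K H M hM hKo.out).symm.continuous.measurable

variable (m : ∀ i, Measure (G i ⧸ H i)) (S₀ : Finset ι)

/-- `μ_Q(A) = μ(e.symm ⁻¹' A) = μ(e '' A)` for EVERY set `A` (measurable equivalence). [cite: BorelJacquet1979, §4.1] -/
theorem map_quotientHomeomorph_symm_apply (A : Set ((Πʳ i, [G i, K i]) ⧸ M)) :
    (rpMeasure (fun i => quotBase K H i) m S₀).map (quotientHomeomorph K H M hM hKo.out).symm A =
      rpMeasure (fun i => quotBase K H i) m S₀ (quotientHomeomorph K H M hM hKo.out '' A) := by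
  haveI := borelSpace_quot K H
  rw [← (quotientHomeomorph K H M hM hKo.out).symm.toMeasurableEquiv_coe, MeasurableEquiv.map_apply,
    Homeomorph.toMeasurableEquiv_coe, Homeomorph.preimage_symm]

/-- Change of variables for `∫⁻` along the homeomorphism (no measurability of `F` needed). [cite: BorelJacquet1979, §4.1] -/
theorem lintegral_map_quotientHomeomorph_symm (F : (Πʳ i, [G i, K i]) ⧸ M → ℝ≥0∞) :
    ∫⁻ p, F p ∂(rpMeasure (fun i => quotBase K H i) m S₀).map (quotientHomeomorph K H M hM hKo.out).symm =
      ∫⁻ z, F ((quotientHomeomorph K H M hM hKo.out).symm z) ∂rpMeasure (fun i => quotBase K H i) m S₀ := by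
  haveI := borelSpace_quot K H
  rw [← (quotientHomeomorph K H M hM hKo.out).symm.toMeasurableEquiv_coe, lintegral_map_equiv]

/-- Change of variables for the Bochner integral along the homeomorphism. [cite: BorelJacquet1979, §4.1] -/
theorem integral_map_quotientHomeomorph_symm {E : Type*} [NormedAddCommGroup E] [NormedSpace ℝ E]
    (F : (Πʳ i, [G i, K i]) ⧸ M → E) :
    ∫ p, F p ∂(rpMeasure (fun i => quotBase K H i) m S₀).map (quotientHomeomorph K H M hM hKo.out).symm =
      ∫ z, F ((quotientHomeomorph K H M hM hKo.out).symm z) ∂rpMeasure (fun i => quotBase K H i) m S₀ := by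
  haveI := borelSpace_quot K H
  rw [← (quotientHomeomorph K H M hM hKo.out).symm.toMeasurableEquiv_coe, integral_map_equiv]

/-- Integrability transports along the homeomorphism. [cite: BorelJacquet1979, §4.1] -/
theorem integrable_map_quotientHomeomorph_symm_iff {E : Type*} [NormedAddCommGroup E]
    (F : (Πʳ i, [G i, K i]) ⧸ M → E) :
    Integrable F ((rpMeasure (fun i => quotBase K H i) m S₀).map (quotientHomeomorph K H M hM hKo.out).symm) ↔
      Integrable (fun z => F ((quotientHomeomorph K H M hM hKo.out).symm z))
        (rpMeasure (fun i => quotBase K H i) m S₀) := by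
  haveI := borelSpace_quot K H
  rw [← (quotientHomeomorph K H M hM hKo.out).symm.toMeasurableEquiv_coe, integrable_map_equiv]
  rfl

variable [∀ i, SigmaFinite (m i)]

/-! ## Invariance, finiteness on compacta, non-vanishing -/

/-- **Invariance.** If the local measures `m i` on `G i ⧸ H i` are `G i`-invariant and `m i (π_i K_i) = 1` off
`S₀`, the transported restricted product measure on `(Πʳ G_i) ⧸ M` is invariant under the left action of
`Πʳ i, [G i, K i]` (`ActionInvariant.map_eq_rpMeasure_of_forall_apply_eq_smul` applied to
`Φ = e ∘ (g • ·) ∘ e⁻¹`, coordinatewise `z_i ↦ g_i • z_i` by `quotientHomeomorph_smul_apply`). [cite: BorelJacquet1979, §4.1] -/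
theorem smulInvariantMeasure_map_quotientHomeomorph_symm [∀ i, SMulInvariantMeasure (G i) (G i ⧸ H i) (m i)]
    (hm1 : ∀ i, i ∉ S₀ → m i (quotBase K H i) = 1) :
    SMulInvariantMeasure (Πʳ i, [G i, K i]) ((Πʳ i, [G i, K i]) ⧸ M)
      ((rpMeasure (fun i => quotBase K H i) m S₀).map (quotientHomeomorph K H M hM hKo.out).symm) := by
  haveI := borelSpace_quot K H
  set e := quotientHomeomorph K H M hM hKo.out with he
  have hes : Measurable e.symm := measurable_quotientHomeomorph_symm K H M hM
  refine ⟨fun g s hs => ?_⟩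
  have hΦ : ∀ z i, e (g • e.symm z) i = g i • z i := fun z i => by
    rw [he, quotientHomeomorph_smul_apply, Homeomorph.apply_symm_apply]
  have hΦm : Measurable (fun z => e (g • e.symm z)) :=
    measurable_of_forall_apply_eq_smul (fun i => quotBase K H i) (measurableSet_quotBase K H) (fun i => g i) _ hΦ
  have hinv := map_eq_rpMeasure_of_forall_apply_eq_smul (fun i => quotBase K H i) m K
    (measurableSet_quotBase K H) (forall_smul_quotBase_eq K H) hm1 (fun i => g i) g.2 _ hΦ
  rw [Measure.map_apply hes (measurable_const_smul g hs), Measure.map_apply hes hs]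
  have hset : e.symm ⁻¹' ((fun p => g • p) ⁻¹' s) = (fun z => e (g • e.symm z)) ⁻¹' (e.symm ⁻¹' s) := by
    ext z
    simp only [mem_preimage, Homeomorph.symm_apply_apply]
  rw [hset, ← Measure.map_apply hΦm (hes hs), hinv]

/-- **Finite on compacta.** If the local measures are finite on compacta (and `m i (π_i K_i) = 1` off `S₀`),
so is the transported restricted product measure on `(Πʳ G_i) ⧸ M`: a compact `Q` maps to a compact subset of
`Πʳ (G_i ⧸ H_i)`, which lies in a cylinder (`ActionInvariant.isFiniteMeasureOnCompacts_rpMeasure`). [cite: BorelJacquet1979, §4.1] -/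
theorem isFiniteMeasureOnCompacts_map_quotientHomeomorph_symm [∀ i, IsFiniteMeasureOnCompacts (m i)]
    (hm1 : ∀ i, i ∉ S₀ → m i (quotBase K H i) = 1) :
    IsFiniteMeasureOnCompacts
      ((rpMeasure (fun i => quotBase K H i) m S₀).map (quotientHomeomorph K H M hM hKo.out).symm) := by
  haveI := isFiniteMeasureOnCompacts_rpMeasure (fun i => quotBase K H i) m
    (fun i => isOpen_quotBase K H (hKo.out i)) (quotBase_nonempty K H) (measurableSet_quotBase K H) hm1
  refine ⟨fun Q hQ => ?_⟩
  rw [map_quotientHomeomorph_symm_apply]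
  exact (hQ.image (quotientHomeomorph K H M hM hKo.out).continuous).measure_lt_top

/-- **Non-zero.** The transported measure is non-zero as soon as the local measures at the places of `S₀` are.
[cite: BorelJacquet1979, §4.1] -/
theorem map_quotientHomeomorph_symm_ne_zero (hm1 : ∀ i, i ∉ S₀ → m i (quotBase K H i) = 1)
    (hm : ∀ i, i ∈ S₀ → m i ≠ 0) :
    (rpMeasure (fun i => quotBase K H i) m S₀).map (quotientHomeomorph K H M hM hKo.out).symm ≠ 0 := by
  rw [Ne, Measure.map_eq_zero_iff (measurable_quotientHomeomorph_symm K H M hM).aemeasurable]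
  exact rpMeasure_ne_zero (fun i => quotBase K H i) m (quotBase_nonempty K H) (measurableSet_quotBase K H) hm1 hm

/-- The mass of the image `π_M(A_{S₀})` of the integral cylinder: `∏_{i∈S₀} m_i(G_i ⧸ H_i)`. [cite: CasselsFrohlichANT1967, Ch. XV (Tate) §3.3] -/
theorem map_quotientHomeomorph_symm_image_mk_box (hm1 : ∀ i, i ∉ S₀ → m i (quotBase K H i) = 1) :
    (rpMeasure (fun i => quotBase K H i) m S₀).map (quotientHomeomorph K H M hM hKo.out).symm
        ((QuotientGroup.mk : (Πʳ i, [G i, K i]) → (Πʳ i, [G i, K i]) ⧸ M) ''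
          {x | ∀ i, i ∉ S₀ → x i ∈ (K i : Set (G i))}) =
      ∏ i ∈ S₀, m i univ := by
  rw [map_quotientHomeomorph_symm_apply, image_quotientHomeomorph_mk_box]
  exact rpMeasure_rpBox_eq_prod (fun i => quotBase K H i) m (quotBase_nonempty K H) (measurableSet_quotBase K H)
    hm1 (Finset.Subset.refl S₀)

/-! ## The Euler product of factorizable integrands on the coset space -/

omit [Countable ι] [∀ i, SecondCountableTopology (G i ⧸ H i)] [MeasurableSpace ((Πʳ i, [G i, K i]) ⧸ M)]
  [BorelSpace ((Πʳ i, [G i, K i]) ⧸ M)] [∀ i, SigmaFinite (m i)] [∀ i, MeasurableSpace (G i ⧸ H i)]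
  [∀ i, BorelSpace (G i ⧸ H i)] in
/-- Book-keeping: a function on the coset space that factorises on the `K`-cylinders,
`F(x M) = ∏_{i∈S} φ_i(x_i H_i)` for `x_i ∈ K_i` off `S`, factorises — after the homeomorphism — on the
cylinders `A_S` of `Πʳ (G_i ⧸ H_i)` (box lemma `image_quotientMap_box`). [cite: BorelJacquet1979, §4.1] -/
theorem forall_rpBox_comp_quotientHomeomorph_symm {β : Type*} [CommMonoid β] (φ : ∀ i, G i ⧸ H i → β)
    (F : (Πʳ i, [G i, K i]) ⧸ M → β) {S₀' : Finset ι}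
    (hF : ∀ S : Finset ι, S₀' ⊆ S → ∀ x : Πʳ i, [G i, K i], (∀ i, i ∉ S → x i ∈ (K i : Set (G i))) →
      F (QuotientGroup.mk x) = ∏ i ∈ S, φ i ((x i : G i) : G i ⧸ H i))
    (S : Finset ι) (hS : S₀' ⊆ S) (z : Πʳ i, [G i ⧸ H i, quotBase K H i])
    (hz : z ∈ rpBox (fun i => quotBase K H i) S) :
    F ((quotientHomeomorph K H M hM hKo.out).symm z) = ∏ i ∈ S, φ i (z i) := by
  have hz' : z ∈ quotientMap K H '' {x : Πʳ i, [G i, K i] | ∀ i, i ∉ S → x i ∈ (K i : Set (G i))} := by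
    rw [image_quotientMap_box]
    exact hz
  obtain ⟨x, hx, rfl⟩ := hz'
  rw [quotientHomeomorph_symm_quotientMap, hF S hS x hx]
  rfl

/-- **Euler product on the coset space (monotone form).** For measurable `φ_i : G_i ⧸ H_i → [0,∞]` and
`F : (Πʳ G_i) ⧸ M → [0,∞]` with `F(x M) = ∏_{i∈S} φ_i(x_i H_i)` whenever `x_i ∈ K_i` for `i ∉ S ⊇ S₀` (so
`φ_i ≡ 1` on `π_i(K_i)` off `S₀` is forced where it matters — the unramified orbital integrand
`1_{K_v}(y γ_v y⁻¹)` is of this kind), `∫⁻ F dμ_Q = ⨆_{S ⊇ S₀} ∏_{i∈S} ∫⁻ φ_i dm_i`.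
[cite: CasselsFrohlichANT1967, Ch. XV (Tate) §3.3, Thm 3.3.1] -/
theorem lintegral_map_quotientHomeomorph_symm_eq_iSup_prod (hm1 : ∀ i, i ∉ S₀ → m i (quotBase K H i) = 1)
    (φ : ∀ i, G i ⧸ H i → ℝ≥0∞) (hφ : ∀ i, Measurable (φ i)) (F : (Πʳ i, [G i, K i]) ⧸ M → ℝ≥0∞)
    (hF : ∀ S : Finset ι, S₀ ⊆ S → ∀ x : Πʳ i, [G i, K i], (∀ i, i ∉ S → x i ∈ (K i : Set (G i))) →
      F (QuotientGroup.mk x) = ∏ i ∈ S, φ i ((x i : G i) : G i ⧸ H i)) :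
    ∫⁻ p, F p ∂(rpMeasure (fun i => quotBase K H i) m S₀).map (quotientHomeomorph K H M hM hKo.out).symm =
      ⨆ (S : Finset ι) (_ : S₀ ⊆ S), ∏ i ∈ S, ∫⁻ y, φ i y ∂(m i) := by
  rw [lintegral_map_quotientHomeomorph_symm]
  exact lintegral_eq_iSup_prod_of_forall_rpBox (fun i => quotBase K H i) m (quotBase_nonempty K H)
    (measurableSet_quotBase K H) hm1 φ hφ _
    (fun S hS z hz => forall_rpBox_comp_quotientHomeomorph_symm K H M hM φ F hF S hS z hz)

/-- **Euler product on the coset space (stabilised form).** If moreover `∫⁻ φ_i dm_i = 1` off a finite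
`S₁ ⊇ S₀` (e.g. the unramified computation `O_{γ_v}(1_{K_v}) = 1`), then `∫⁻ F dμ_Q = ∏_{i∈S₁} ∫⁻ φ_i dm_i`.
[cite: CasselsFrohlichANT1967, Ch. XV (Tate) §3.3, Thm 3.3.1] -/
theorem lintegral_map_quotientHomeomorph_symm_eq_prod (hm1 : ∀ i, i ∉ S₀ → m i (quotBase K H i) = 1)
    (φ : ∀ i, G i ⧸ H i → ℝ≥0∞) (hφ : ∀ i, Measurable (φ i)) (F : (Πʳ i, [G i, K i]) ⧸ M → ℝ≥0∞)
    (hF : ∀ S : Finset ι, S₀ ⊆ S → ∀ x : Πʳ i, [G i, K i], (∀ i, i ∉ S → x i ∈ (K i : Set (G i))) →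
      F (QuotientGroup.mk x) = ∏ i ∈ S, φ i ((x i : G i) : G i ⧸ H i))
    {S₁ : Finset ι} (hS₁ : S₀ ⊆ S₁) (hφ1 : ∀ i, i ∉ S₁ → ∫⁻ y, φ i y ∂(m i) = 1) :
    ∫⁻ p, F p ∂(rpMeasure (fun i => quotBase K H i) m S₀).map (quotientHomeomorph K H M hM hKo.out).symm =
      ∏ i ∈ S₁, ∫⁻ y, φ i y ∂(m i) := by
  rw [lintegral_map_quotientHomeomorph_symm]
  exact lintegral_eq_prod_of_forall_rpBox (fun i => quotBase K H i) m (quotBase_nonempty K H)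
    (measurableSet_quotBase K H) hm1 φ hφ _
    (fun S hS z hz => forall_rpBox_comp_quotientHomeomorph_symm K H M hM φ F hF S hS z hz) hS₁ hφ1

/-- **Euler product on the coset space (dominated form, scalar factors).** For `F : (Πʳ G_i) ⧸ M → 𝕜`
INTEGRABLE for `μ_Q` and factorising on the `K`-cylinders, the partial Euler products converge:
`∏_{i∈T} ∫ φ_i dm_i ⟶ ∫ F dμ_Q` as `T ↑`. [cite: CasselsFrohlichANT1967, Ch. XV (Tate) §3.3, Thm 3.3.1] -/
theorem tendsto_prod_integral_map_quotientHomeomorph_symm (hm1 : ∀ i, i ∉ S₀ → m i (quotBase K H i) = 1)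
    {𝕜 : Type*} [RCLike 𝕜] (φ : ∀ i, G i ⧸ H i → 𝕜) (F : (Πʳ i, [G i, K i]) ⧸ M → 𝕜)
    (hF : ∀ S : Finset ι, S₀ ⊆ S → ∀ x : Πʳ i, [G i, K i], (∀ i, i ∉ S → x i ∈ (K i : Set (G i))) →
      F (QuotientGroup.mk x) = ∏ i ∈ S, φ i ((x i : G i) : G i ⧸ H i))
    (hFi : Integrable F
      ((rpMeasure (fun i => quotBase K H i) m S₀).map (quotientHomeomorph K H M hM hKo.out).symm)) :
    Tendsto (fun T : Finset ι => ∏ i ∈ T, ∫ y, φ i y ∂(m i)) atTop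
      (𝓝 (∫ p, F p ∂(rpMeasure (fun i => quotBase K H i) m S₀).map (quotientHomeomorph K H M hM hKo.out).symm)) := by
  rw [integral_map_quotientHomeomorph_symm]
  rw [integrable_map_quotientHomeomorph_symm_iff] at hFi
  exact tendsto_prod_integral_of_forall_rpBox (fun i => quotBase K H i) m (quotBase_nonempty K H)
    (measurableSet_quotBase K H) hm1 φ _
    (fun S hS z hz => forall_rpBox_comp_quotientHomeomorph_symm K H M hM φ F hF S hS z hz) hFi

/-- **Euler product on the coset space (stabilised form, scalar factors).** If `F` is integrable, factorises on
the `K`-cylinders, and `∫ φ_i dm_i = 1` off a finite `S₁`, then `∫ F dμ_Q = ∏_{i∈S₁} ∫ φ_i dm_i` — the Euler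
factorisation of the orbital integral of a pure tensor over `G(𝔸) ⧸ G_γ(𝔸) = Πʳ_v G_v ⧸ G_{γ,v}` once the local
factors are normalised off `S₁`. [cite: CasselsFrohlichANT1967, Ch. XV (Tate) §3.3, Thm 3.3.1] -/
theorem integral_map_quotientHomeomorph_symm_eq_prod (hm1 : ∀ i, i ∉ S₀ → m i (quotBase K H i) = 1)
    {𝕜 : Type*} [RCLike 𝕜] (φ : ∀ i, G i ⧸ H i → 𝕜) (F : (Πʳ i, [G i, K i]) ⧸ M → 𝕜)
    (hF : ∀ S : Finset ι, S₀ ⊆ S → ∀ x : Πʳ i, [G i, K i], (∀ i, i ∉ S → x i ∈ (K i : Set (G i))) →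
      F (QuotientGroup.mk x) = ∏ i ∈ S, φ i ((x i : G i) : G i ⧸ H i))
    (hFi : Integrable F
      ((rpMeasure (fun i => quotBase K H i) m S₀).map (quotientHomeomorph K H M hM hKo.out).symm))
    {S₁ : Finset ι} (hφ1 : ∀ i, i ∉ S₁ → ∫ y, φ i y ∂(m i) = 1) :
    ∫ p, F p ∂(rpMeasure (fun i => quotBase K H i) m S₀).map (quotientHomeomorph K H M hM hKo.out).symm =
      ∏ i ∈ S₁, ∫ y, φ i y ∂(m i) := by
  rw [integral_map_quotientHomeomorph_symm]
  rw [integrable_map_quotientHomeomorph_symm_iff] at hFi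
  exact integral_eq_prod_of_forall_rpBox (fun i => quotBase K H i) m (quotBase_nonempty K H)
    (measurableSet_quotBase K H) hm1 φ _
    (fun S hS z hz => forall_rpBox_comp_quotientHomeomorph_symm K H M hM φ F hF S hS z hz) hFi hφ1

end Literature.MeasureTheory.RestrictedProduct

end
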